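import Mathlib
import HarnessLib
import Literature.MathematicalPhysics.StatisticalMechanics.LinearisedMapNormRay
import Literature.MathematicalPhysics.StatisticalMechanics.LinearisedMapKernelSub

/-!
# Lemma 10.1 for the DIFFERENCE of two step kernels WITHOUT locality of the weights
# ([ABKM19] Lemma 10.1 ⊗ Lemma 8.4 (`ℓ = 1`); the variant consumed by the torus weight tower)

`LinearisedMapKernelSub.weakNormLE_opC_sub` carries the hypotheses `P.W.Local nb`, `nb k X ⊆ X*` of
`LinearisedMapNorm`, which the [ABKM19] weights do not satisfy (`w_k^X` lives on `X^{++} ⊋ X*`).  As in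
`LinearisedMapNormRay` (ray form of Lemma 10.3, `tayNormLE_Pi2Rem_of_w9_of_ray`) we re-derive the
two-kernel statements without them:

* **`tayNormLE_blockTerm_sub_of_ray`** — Lemmas 10.3–10.4 for `G_a(B) − G_b(B)`;
* **`weakNormLE_opC_sub_of_ray`** — `‖C_a K − C_b K‖_{k+1}^{(A)} ≤ C · (L^d · 1536 ℓκ c_G + ℓ ε(A, κ))`.

Everything is proved; no named fact.

## References
* S. Adams, S. Buchholz, R. Kotecký, S. Müller, arXiv:1910.13564, Lemma 10.1–10.4, Lemma 12.6 (12.53)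
  [AdamsBuchholzKoteckyMuller2019].
-/

noncomputable section

namespace Literature.MathematicalPhysics.StatisticalMechanics.GradientRG

open scoped BigOperators Classical
open Finset
open Literature.MathematicalPhysics.StatisticalMechanics.TorusPolymer
  (IsPolymer blocks numBlocks closure reblock blockOf thicken mem_blocks mem_blockOf blockOf_eq_of_mem
    mem_blockOf_self isPolymer_blockOf blocks_blockOf card_blocks_eq_numBlocks boxCorner
    blockCenter subset_thicken thicken_mono thicken_mono_rad)
open Literature.Barriers.CriticalPhenomena.LongRangePhi4.Polymer (IsConn)
open Literature.MathematicalPhysics.QuantumFieldTheory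

variable {d M : ℕ} [NeZero M]

/-- **Lemmas 10.3–10.4 for the DIFFERENCE of the block terms of two step kernels, no locality of the
weights** (two-kernel twin of `tayNormLE_blockTerm_of_ray`, the variant consumed by the [ABKM19] weight
tower): `|G_a(B) − G_b(B)|_{k+1,U,T_φ} ≤ C (1536 ℓκ c_G) A^{−1} w_{k+1}^U(φ)` from the `ℓ = 1`
integration property of the pair. [cite: AdamsBuchholzKoteckyMuller2019, Lemma 10.4 (10.13) / Lemma 12.6 (12.53)] -/
theorem tayNormLE_blockTerm_sub_of_ray (P : NormParams d M) {k t : ℕ} (hM : M = P.L ^ (k + 1) * t)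
    (hL : Odd P.L) (ht : Odd t) (D Db : StepData d M) (hDs : D.s = P.L ^ k)
    {x₀ : Fin d → ZMod M} (hB₀ : D.B₀ = blockOf (P.L ^ k) x₀)
    (hc₀ : D.c₀ = boxCorner (P.L ^ k) (P.rad k) x₀) (hC𝒞 : (Matrix.circulant D.𝒞).PosSemidef)
    (hDbs : Db.s = D.s) (hDbB : Db.B₀ = D.B₀) (hDbc : Db.c₀ = D.c₀) (hC𝒞b : (Matrix.circulant Db.𝒞).PosSemidef)
    -- gauges of the two scales
    (h𝔥 : 0 < P.𝔥 (k + 1)) (h𝔥le : P.𝔥 (k + 1) ≤ P.𝔥 k) {κ₁ : ℝ} (hκ₁ : P.𝔥 (k + 1) ≤ κ₁ * P.𝔥 k)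
    (hR : 0 < P.R k) (hRsucc : P.R (k + 1) = P.L * P.R k) (hθ : P.𝔥 (k + 1) / P.𝔥 k * (P.R k / P.R (k + 1)) ≤ 1)
    (hp : d / 2 + 2 ≤ P.p) (hr₀ : 3 ≤ P.r₀) (hrad : P.rad k ≤ P.rad (k + 1))
    -- the box `B*`
    (hwrap : 4 * ((P.L ^ k - 1) / 2 + P.rad k) < M)
    (hroom : ((2 * ((P.L ^ k - 1) / 2 + P.rad k) : ℕ) + (P.p : ℤ)) * 2 < M)
    {C₁ C₀ : ℝ} (hC₁ : 0 ≤ C₁) (hρ : ((2 * ((P.L ^ k - 1) / 2 + P.rad k) : ℕ) : ℝ) ≤ C₁ * P.R k)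
    (hC₀ : 1 ≤ C₀) (hρ0 : ((2 * ((P.L ^ k - 1) / 2 + P.rad k) : ℕ) : ℝ) + (d / 2 + 1 : ℕ) ≤ C₀ * P.R k)
    -- weights
    {Dm : ℕ → Matrix (Fin d → ZMod M) (Fin d → ZMod M) ℝ} (hWd : P.W.Dominated Dm) (hWm : P.W.Monotone)
    -- the activity
    {ℓ κ : ℝ} (hℓ : 0 ≤ ℓ) (hκ : 0 ≤ κ)
    (hdint : ∀ X : Finset (Fin d → ZMod M), IsPolymer (P.L ^ k) X → IsConn X →
      ∀ (F : ((Fin d → ZMod M) → ℝ) → ℂ) (C : ℝ), 0 ≤ C → ContDiff ℝ P.r₀ F →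
        IsGaugeLocal (P.gauge k X) F → TayNormLE (P.gauge k X) P.r₀ (P.W.weight k X) F C →
          TayNormLE (P.gauge k X) P.r₀ (P.W.midWeight k X) (fluct D.𝒞 F - fluct Db.𝒞 F)
            (C * ℓ * κ ^ numBlocks (P.L ^ k) X))
    {K : Finset (Fin d → ZMod M) → ((Fin d → ZMod M) → ℝ) → ℂ} {C : ℝ} (hC : 0 ≤ C)
    (hK : WeakNormLE P k K C) (hKt : TransInv D.s K) (hKd : ∀ X, ContDiff ℝ P.r₀ (K X))
    (hKloc : ∀ X, IsPolymer (P.L ^ k) X → IsConn X → IsGaugeLocal (P.gauge k X) (K X))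
    (hRd : ∀ X, ContDiff ℝ P.r₀ (fluct D.𝒞 (K X))) (hRb : ∀ X, ContDiff ℝ P.r₀ (fluct Db.𝒞 (K X)))
    (hA : 1 ≤ P.A)
    {U : Finset (Fin d → ZMod M)} (hw9 : W9At P k U)
    {B : Finset (Fin d → ZMod M)} (hB : B ∈ blockPartIndex D U) :
    TayNormLE (P.gauge (k + 1) U) P.r₀ (P.W.weight (k + 1) U) (blockTerm D K B - blockTerm Db K B)
      (C * (1536 * (ℓ * κ) * blockContrConst d (P.𝔥 k) (P.𝔥 (k + 1)) (P.R k) (P.R (k + 1)) P.L κ₁ C₁ C₀) * P.A⁻¹) := by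
  -- scales and the torus
  set s := P.L ^ k with hsdef
  have hsodd : Odd s := hL.pow
  have hLs : P.L * s = P.L ^ (k + 1) := (pow_succ' P.L k).symm
  have hMs : M = s * (P.L * t) := hM.trans (by rw [pow_succ]; ring)
  have hLt : Odd (P.L * t) := hL.mul ht
  have hMo : Odd M := by rw [hMs]; exact hsodd.mul hLt
  have hA0 : 0 < P.A := by linarith
  have h𝔥k : 0 < P.𝔥 k := h𝔥.trans_le h𝔥le
  have hR' : 0 < P.R (k + 1) := by rw [hRsucc]; exact mul_pos (by exact_mod_cast hL.pos) hR
  have hp1 : 1 ≤ P.p := by omega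
  -- the block `B = B_y`, `U = B̄`
  obtain ⟨hBbl, hcl⟩ := mem_filter.1 hB
  obtain ⟨y, -, rfl⟩ := mem_blocks.1 hBbl
  rw [hDs] at hcl ⊢
  have hBU : blockOf s y ⊆ U := by rw [← hcl]; exact TorusPolymer.subset_closure _ _
  -- `B` as a translate of `B₀`, and the box data of `B*`
  set v := blockCenter s y - blockCenter s x₀ with hv
  have hvlat : TorusPolymer.IsLatticeVec D.s v := by
    rw [hDs]; exact TorusPolymer.isLatticeVec_blockCenter_sub s y x₀
  have hBtr : blockOf s y = TorusPolymer.translate v D.B₀ := by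
    rw [hB₀]; exact blockOf_eq_translate_blockCenter_sub hMs hsodd hLt x₀ y
  set a := boxCorner s (P.rad k) y with ha
  have hac : D.c₀ + v = a := by rw [hc₀, ha, hv, TorusPolymer.boxCorner_eq_add s (P.rad k) x₀ y]
  set S := thicken (P.rad k) (blockOf s y) with hSdef
  set ρ' : ℕ := 2 * ((s - 1) / 2 + P.rad k) with hρ'
  have hS : ∀ x, x ∈ S ↔ InBox a ρ' x := fun x =>
    TorusPolymer.mem_thicken_blockOf_iff_inBox hMs hsodd hLt hwrap y x
  have haa : InBox a ρ' a := TorusPolymer.inBox_self a ρ'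
  have hroomS : ∀ x ∈ S, HasRoom a x P.p := fun x hx =>
    TorusPolymer.hasRoom_of_inBox ((hS x).1 hx) hroom
  have hBS : blockOf s y ⊆ S := subset_thicken _ _
  have hBne : (blockOf s y).card ≠ 0 := (card_pos.2 ⟨y, mem_blockOf_self s y⟩).ne'
  -- the difference of the block terms is the `Π₂`-remainder at `B` of `F = (R_a − R_b) K(B)`
  have hr2 : (2 : WithTop ℕ∞) ≤ P.r₀ := by exact_mod_cast (show 2 ≤ P.r₀ by omega)
  have hvlat' : TorusPolymer.IsLatticeVec Db.s v := by rw [hDbs]; exact hvlat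
  have hKt' : TransInv Db.s K := by rw [hDbs]; exact hKt
  have hGeq : blockTerm D K (blockOf s y) - blockTerm Db K (blockOf s y) =
      Pi2Rem a (blockOf s y) (fluct D.𝒞 (K (blockOf s y)) - fluct Db.𝒞 (K (blockOf s y))) := by
    have ha' : Db.c₀ + v = a := by rw [hDbc]; exact hac
    have h1 : blockTerm D K (blockOf s y) = Pi2Rem a (blockOf s y) (fluct D.𝒞 (K (blockOf s y))) := by
      rw [hBtr, blockTerm_eq_Pi2Rem D hC𝒞 hKt hvlat, hac]
    have h2 : blockTerm Db K (blockOf s y) = Pi2Rem a (blockOf s y) (fluct Db.𝒞 (K (blockOf s y))) := by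
      rw [hBtr, ← hDbB, blockTerm_eq_Pi2Rem Db hC𝒞b hKt' hvlat', ha']
    rw [h1, h2]
    unfold Pi2Rem
    rw [Pi2_sub_of_contDiff _ _ ((hRd _).of_le hr2) ((hRb _).of_le hr2)]
    funext φ
    simp only [Pi.sub_apply, eval_sub]
    ring
  set F := fluct D.𝒞 (K (blockOf s y)) - fluct Db.𝒞 (K (blockOf s y)) with hF
  -- `F` is local and `C^{r₀}`, and `|F|_{T_ψ} ≤ C κ A^{-1} w_{k:k+1}^B(ψ)` (norm of `K` + Lemma 8.4)
  have hPB : IsPolymer (P.L ^ k) (blockOf s y) := isPolymer_blockOf _ y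
  have hcB : IsConn (blockOf s y) := TorusPolymer.isConn_blockOf hMo hsodd y
  have hgauge : P.gauge k (blockOf s y) = fieldGauge (P.𝔥 k) (P.R k) P.p S := rfl
  have hlocK : IsGaugeLocal (fieldGauge (P.𝔥 k) (P.R k) P.p S) (K (blockOf s y)) := hKloc _ hPB hcB
  have hlocFa : IsGaugeLocal (fieldGauge (P.𝔥 k) (P.R k) P.p S) (fluct D.𝒞 (K (blockOf s y))) :=
    isGaugeLocal_integral _ (stepMeasure D.𝒞) fun ξ => hlocK.comp_add_right _ ξ
  have hlocFb : IsGaugeLocal (fieldGauge (P.𝔥 k) (P.R k) P.p S) (fluct Db.𝒞 (K (blockOf s y))) :=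
    isGaugeLocal_integral _ (stepMeasure Db.𝒞) fun ξ => hlocK.comp_add_right _ ξ
  have hlocF : IsGaugeLocal (fieldGauge (P.𝔥 k) (P.R k) P.p S) F := fun φ ψ hφψ => by
    simp only [hF, Pi.sub_apply]
    rw [hlocFa φ ψ hφψ, hlocFb φ ψ hφψ]
  have hFd : ContDiff ℝ P.r₀ F := (hRd _).sub (hRb _)
  have hnB : numBlocks (P.L ^ k) (blockOf s y) = 1 := by
    rw [← card_blocks_eq_numBlocks, blocks_blockOf, card_singleton]
  have hFw : ∀ ψ, tayNorm (fieldGauge (P.𝔥 k) (P.R k) P.p S) P.r₀ F ψ ≤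
      C * P.A⁻¹ * (ℓ * κ) * P.W.midWeight k (blockOf s y) ψ := by
    have h1 := hdint _ hPB hcB (K (blockOf s y)) (C * P.aFactor k (blockOf s y))
      (mul_nonneg hC (WeakNormLE.aFactor_pos hA0 k _).le) (hKd _) (hgauge ▸ hlocK) (hK _ hPB hcB)
    intro ψ
    have := h1 ψ
    rw [hnB, pow_one, NormParams.aFactor, hnB, pow_one] at this
    calc _ ≤ C * (P.A)⁻¹ * ℓ * κ * P.W.midWeight k (blockOf s y) ψ := this
      _ = C * P.A⁻¹ * (ℓ * κ) * P.W.midWeight k (blockOf s y) ψ := by ring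
  -- the weight `w_{k:k+1}^B` as regulator (evaluated along rays only), and (w9) on `U* ⊇ B*`
  have hw1 : ∀ ψ, 1 ≤ P.W.midWeight k (blockOf s y) ψ := WeightData.one_le_midWeight hWd k _
  have hSS' : S ⊆ thicken (P.rad (k + 1)) U :=
    (thicken_mono _ hBU).trans (thicken_mono_rad hrad U)
  have hw9' : ∀ φ, Real.exp (‖fieldGauge (P.𝔥 (k + 1)) (P.R (k + 1)) P.p (thicken (P.rad (k + 1)) U) φ‖ ^ 2 / 2)
      * P.W.midWeight k (blockOf s y) φ ≤ P.W.weight (k + 1) U φ := fun φ =>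
    (mul_le_mul_of_nonneg_left (WeightData.midWeight_mono hWd hWm k hBU φ) (Real.exp_pos _).le).trans
      (hw9 φ)
  -- Lemma 10.3 (ray form) + (w9)
  have hmain := tayNormLE_Pi2Rem_of_w9_of_ray (𝕜 := ℂ) hS haa hroomS hp hBS hBne h𝔥k h𝔥 hR
    (by exact_mod_cast hL.pos : (1 : ℝ) ≤ P.L) hRsucc hκ₁ h𝔥le hC₁ hρ hC₀ hρ0 hθ hr₀ hFd hlocF
    hw1 (WeightData.midWeight_zero k _) (fun ψ t ht => WeightData.midWeight_smul_le hWd k _ ψ ht)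
    (by positivity : 0 ≤ C * P.A⁻¹ * (ℓ * κ)) hFw hSS' hw9'
  rw [hGeq]
  intro φ
  refine (hmain φ).trans (le_of_eq ?_)
  show _ = C * (1536 * (ℓ * κ) * blockContrConst d (P.𝔥 k) (P.𝔥 (k + 1)) (P.R k) (P.R (k + 1)) P.L κ₁ C₁ C₀) *
    P.A⁻¹ * P.W.weight (k + 1) U φ
  ring

/-- **Lemma 10.1 (norm form) for the difference of two step kernels, no locality of the weights**
(the variant consumed by the [ABKM19] weight tower):
`‖C_a K − C_b K‖_{k+1}^{(A)} ≤ C · (L^d · 1536 ℓκ c_G + ℓ ε(A, κ))` for step data `D, Db` of scale `k`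
sharing `s, L, B₀, c₀`, under the hypotheses of `weakNormLE_opC` with the integration property
replaced by the `ℓ = 1` property of the pair (`hdint`) and `C^{r₀}` fluctuation integrals under both
kernels. [cite: AdamsBuchholzKoteckyMuller2019, Lemma 10.1 / Lemma 12.6 (12.53)] -/
theorem weakNormLE_opC_sub_of_ray (P : NormParams d M) {k t : ℕ} (hM : M = P.L ^ (k + 1) * t)
    (hL : Odd P.L) (ht : Odd t) (D Db : StepData d M) (hDs : D.s = P.L ^ k) (hDL : D.L = P.L)
    {x₀ : Fin d → ZMod M} (hB₀ : D.B₀ = blockOf (P.L ^ k) x₀)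
    (hc₀ : D.c₀ = boxCorner (P.L ^ k) (P.rad k) x₀) (hC𝒞 : (Matrix.circulant D.𝒞).PosSemidef)
    (hDbs : Db.s = D.s) (hDbL : Db.L = D.L) (hDbB : Db.B₀ = D.B₀) (hDbc : Db.c₀ = D.c₀)
    (hC𝒞b : (Matrix.circulant Db.𝒞).PosSemidef)
    -- gauges of the two scales
    (h𝔥 : 0 < P.𝔥 (k + 1)) (h𝔥le : P.𝔥 (k + 1) ≤ P.𝔥 k) {κ₁ : ℝ} (hκ₁ : P.𝔥 (k + 1) ≤ κ₁ * P.𝔥 k)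
    (hR : 0 < P.R k) (hRsucc : P.R (k + 1) = P.L * P.R k)
    (hθ : P.𝔥 (k + 1) / P.𝔥 k * (P.R k / P.R (k + 1)) ≤ 1)
    (hp : d / 2 + 2 ≤ P.p) (hr₀ : 3 ≤ P.r₀) (hrad : P.rad k ≤ P.rad (k + 1))
    (hrad' : P.rad k + (2 ^ d - 1) * P.L ^ k ≤ P.rad (k + 1))
    -- the box `B*`
    (hwrap : 4 * ((P.L ^ k - 1) / 2 + P.rad k) < M)
    (hroom : ((2 * ((P.L ^ k - 1) / 2 + P.rad k) : ℕ) + (P.p : ℤ)) * 2 < M)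
    {C₁ C₀ : ℝ} (hC₁ : 0 ≤ C₁) (hρ : ((2 * ((P.L ^ k - 1) / 2 + P.rad k) : ℕ) : ℝ) ≤ C₁ * P.R k)
    (hC₀ : 1 ≤ C₀) (hρ0 : ((2 * ((P.L ^ k - 1) / 2 + P.rad k) : ℕ) : ℝ) + (d / 2 + 1 : ℕ) ≤ C₀ * P.R k)
    -- weights
    {Dm : ℕ → Matrix (Fin d → ZMod M) (Fin d → ZMod M) ℝ} (hWd : P.W.Dominated Dm) (hWm : P.W.Monotone)
    (hw6 : NextWeightDominates P k) (hw9 : ∀ U, IsPolymer (P.L ^ (k + 1)) U → W9At P k U)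
    -- pair integration property, large-set parameter, gain
    {ℓ κ η : ℝ} (hℓ : 0 ≤ ℓ) (hκ : 0 ≤ κ) (hκA : κ ≤ P.A) (hA : 1 ≤ P.A) (hη : 0 < η)
    (hdint : ∀ X : Finset (Fin d → ZMod M), IsPolymer (P.L ^ k) X → IsConn X →
      ∀ (F : ((Fin d → ZMod M) → ℝ) → ℂ) (C : ℝ), 0 ≤ C → ContDiff ℝ P.r₀ F →
        IsGaugeLocal (P.gauge k X) F → TayNormLE (P.gauge k X) P.r₀ (P.W.weight k X) F C →
          TayNormLE (P.gauge k X) P.r₀ (P.W.midWeight k X) (fluct D.𝒞 F - fluct Db.𝒞 F)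
            (C * ℓ * κ ^ numBlocks (P.L ^ k) X))
    (hsmall : (2 : ℝ) ^ (P.L ^ d) * (κ * P.A ^ (-(1 - η⁻¹) : ℝ)) ≤ 1)
    (hgain : ∀ X : Finset (Fin d → ZMod M), IsPolymer (P.L ^ k) X → IsConn X →
      2 ^ d < (blocks (P.L ^ k) X).card →
        η * ((blocks (P.L * P.L ^ k) (closure (P.L * P.L ^ k) X)).card : ℝ) ≤ (blocks (P.L ^ k) X).card)
    -- the activity
    {K : Finset (Fin d → ZMod M) → ((Fin d → ZMod M) → ℝ) → ℂ} {C : ℝ} (hC : 0 ≤ C)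
    (hK : WeakNormLE P k K C) (hKt : TransInv D.s K) (hKd : ∀ X, ContDiff ℝ P.r₀ (K X))
    (hKloc : ∀ X, IsPolymer (P.L ^ k) X → IsConn X → IsGaugeLocal (P.gauge k X) (K X))
    (hRd : ∀ X, ContDiff ℝ P.r₀ (fluct D.𝒞 (K X))) (hRb : ∀ X, ContDiff ℝ P.r₀ (fluct Db.𝒞 (K X))) :
    WeakNormLE P (k + 1) (opC D K - opC Db K)
      (C * ((P.L : ℝ) ^ d * (1536 * (ℓ * κ) * blockContrConst d (P.𝔥 k) (P.𝔥 (k + 1)) (P.R k) (P.R (k + 1))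
        P.L κ₁ C₁ C₀) + ℓ * largePartEps d P.L P.A κ η)) := by
  intro U hU hcU
  have hLs : P.L * P.L ^ k = P.L ^ (k + 1) := (pow_succ' P.L k).symm
  have hLDs : D.L * D.s = P.L ^ (k + 1) := by rw [hDL, hDs, hLs]
  have hM' : M = D.L * D.s * t := hM.trans (by rw [hLDs])
  have hRle : P.R k ≤ P.R (k + 1) := by
    rw [hRsucc]
    have h1 : (1 : ℝ) ≤ P.L := by exact_mod_cast hL.pos
    nlinarith
  set cG := 1536 * κ * blockContrConst d (P.𝔥 k) (P.𝔥 (k + 1)) (P.R k) (P.R (k + 1)) P.L κ₁ C₁ C₀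
    with hcG
  -- the per-block bounds (Lemmas 10.3–10.4 for the pair)
  have hG : ∀ B ∈ blockPartIndex D U, TayNormLE (P.gauge (k + 1) U) P.r₀ (P.W.weight (k + 1) U)
      (blockTerm D K B - blockTerm Db K B) (C * ℓ * cG * P.A⁻¹) := fun B hB =>
    (tayNormLE_blockTerm_sub_of_ray P hM hL ht D Db hDs hB₀ hc₀ hC𝒞 hDbs hDbB hDbc hC𝒞b h𝔥 h𝔥le hκ₁ hR hRsucc
      hθ hp hr₀ hrad hwrap hroom hC₁ hρ hC₀ hρ0 hWd hWm hℓ hκ hdint hC hK hKt hKd hKloc hRd hRb hA (hw9 U hU)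
      hB).mono (le_of_eq (by rw [hcG]; ring)) fun φ => (P.W.weight_pos (k + 1) U φ).le
  have hκ₁0 : 0 ≤ κ₁ := ((mul_pos_iff_of_pos_right (h𝔥.trans_le h𝔥le)).1 (h𝔥.trans_le hκ₁)).le
  have hcG0 : 0 ≤ cG := by
    have := blockContrConst_nonneg d (h𝔥.trans_le h𝔥le) h𝔥.le hR.le (hR.trans_le hRle)
      (show (0 : ℝ) < (P.L : ℝ) by exact_mod_cast hL.pos) hκ₁0 hC₁ (show (0 : ℝ) ≤ C₀ by linarith)
    rw [hcG]; positivity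
  -- the per-polymer bounds (Lemma 8.4 (ℓ = 1) + 8.1 + (w6)) with constant `C ℓ`
  have hMk : M = P.L ^ k * (P.L * t) := hM.trans (by rw [pow_succ]; ring)
  have hA0 : 0 < P.A := by linarith
  have hRbd : ∀ X ∈ largePartIndex D.s D.L U, TayNormLE (P.gauge (k + 1) U) P.r₀ (P.W.weight (k + 1) U)
      (fluct D.𝒞 (K X) - fluct Db.𝒞 (K X))
      (C * ℓ * (κ ^ (blocks D.s X).card * (P.A ^ (blocks D.s X).card)⁻¹)) := by
    intro X hX
    obtain ⟨hPX, hcX, -, hr⟩ := mem_largePartIndex.1 hX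
    rw [hDs] at hPX hr ⊢
    rw [hDL] at hr
    have h1 := hdint X hPX hcX (K X) (C * P.aFactor k X)
      (mul_nonneg hC (WeakNormLE.aFactor_pos hA0 k X).le) (hKd X) (hKloc X hPX hcX) (hK X hPX hcX)
    have hloca : IsGaugeLocal (P.gauge k X) (fluct D.𝒞 (K X)) :=
      isGaugeLocal_integral (P.gauge k X) (stepMeasure D.𝒞) fun ξ => (hKloc X hPX hcX).comp_add_right _ ξ
    have hlocb : IsGaugeLocal (P.gauge k X) (fluct Db.𝒞 (K X)) :=
      isGaugeLocal_integral (P.gauge k X) (stepMeasure Db.𝒞) fun ξ => (hKloc X hPX hcX).comp_add_right _ ξ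
    have hloc : IsGaugeLocal (P.gauge k X) (fluct D.𝒞 (K X) - fluct Db.𝒞 (K X)) := fun φ ψ hφψ => by
      simp only [Pi.sub_apply]
      rw [hloca φ ψ hφψ, hlocb φ ψ hφψ]
    have h2 : TayNormLE (P.gauge (k + 1) U) P.r₀ (P.W.midWeight k X) (fluct D.𝒞 (K X) - fluct Db.𝒞 (K X))
        (C * P.aFactor k X * ℓ * κ ^ numBlocks (P.L ^ k) X) := by
      rw [← hr]
      exact h1.of_le_gauge (fun ξ => norm_gauge_le_norm_gauge_succ P hMk hL (hL.mul ht) h𝔥 h𝔥le hR hRle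
        hrad hrad' X ξ) ((hRd X).sub (hRb X)) hloc
    have hc0 : 0 ≤ C * P.aFactor k X * ℓ * κ ^ numBlocks (P.L ^ k) X :=
      mul_nonneg (mul_nonneg (mul_nonneg hC (WeakNormLE.aFactor_pos hA0 k X).le) hℓ) (pow_nonneg hκ _)
    have h3 : TayNormLE (P.gauge (k + 1) U) P.r₀ (P.W.weight (k + 1) U) (fluct D.𝒞 (K X) - fluct Db.𝒞 (K X))
        (C * P.aFactor k X * ℓ * κ ^ numBlocks (P.L ^ k) X) :=
      h2.mono_weight hc0 fun φ => by rw [← hr]; exact hw6 X hPX hcX φ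
    refine h3.mono (le_of_eq ?_) fun φ => (P.W.weight_pos (k + 1) U φ).le
    rw [NormParams.aFactor, ← card_blocks_eq_numBlocks]; ring
  have hmain := tayNormLE_opC_sub D Db hDbs hDbL hM' (hDs ▸ hL.pow) (hDL ▸ hL) ht (P.gauge (k + 1) U)
    (w := P.W.weight (k + 1) U) (fun φ => (P.W.weight_pos (k + 1) U φ).le) (K := K) hA hκ hκA hη
    (mul_nonneg hC hℓ) hcG0 (by rwa [hDL]) (by rw [hDs, hDL]; exact hgain) (by rwa [hLDs]) hcU.1
    (fun B _ => (contDiff_blockTerm D hRd B).sub (contDiff_blockTerm Db hRb B)) hG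
    (fun X _ => (hRd X).sub (hRb X)) hRbd
  refine hmain.mono (le_of_eq ?_) fun φ => (P.W.weight_pos (k + 1) U φ).le
  rw [NormParams.aFactor, ← card_blocks_eq_numBlocks, hLDs, hDL]
  ring

end Literature.MathematicalPhysics.StatisticalMechanics.GradientRG

end
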